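import Summits.QuantumFields.YangMills.Theorems.LangevinControlUVOSLegsAtWeakCouplingCSketchConditional2
import HarnessLib

/-!
# Crux `OSLegsAtWeakCouplingC` (stmt-QuantumFields-16207), line `Sketch`: the crux from `stub_fcp6` and a WEAKER germ import

Support file (lead c3).  The landed composition `osLegsAtWeakCouplingC_of_fcp6_germ` (…SketchConditional2, p133906)
takes the E1 import `Statement.stub_germ`: along every weak-coupling soft bundle the one-field limit `S₁` is invariant
ON THE GERM under EVERY isometry of the `(x₀,x₁)`-plane.  Two remarks make that import logically weaker at no cost to
the composition, and this file records the sharpened form as a kernel-checked conditional theorem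
(`osLegsAtWeakCouplingC_of_fcp6_germRot`), so that the planner can promote the weaker statement:

* only planar isometries of DETERMINANT ONE (rotations of the `(x₀,x₁)`-plane) are ever consumed — the Givens
  generation `PlanarToEuclidean_proof` asks for det-1 planar invariance only, and `stub_locality` upgrades germ
  invariance to invariance isometry by isometry (`isEuclideanInvariant_of_planarRot`);
* at the point of use the line has already PROVED, for the same `S₁`, reflection positivity on positive-time tuples
  (`RPPos`, the rope p133794), bounded densities off the diagonal (`OffDiagDensity`, p123998) and invariance under all
  signed permutations of the axes (p115564), and the hypotheses H2 and the frozen-boundary package are in hand; the germ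
  statement may therefore assume all of them.

The weakened import (hypothesis `hgerm` below, stated inline; tree vocabulary only): for compact simple `G`, continuous
`a` with H1, H2, H3, any soft bundle `SoftBundle G r a sch S₁ Tq K b₀ g` whose limit `S₁` is `RPPos`, has `OffDiagDensity`
and is signed-permutation invariant, there is `r₀ > 0` such that every det-1 isometry of the `(x₀,x₁)`-plane fixes `S₁`
on off-diagonal test functions supported in configurations of diameter `< r₀`.  Everything else is the landed
composition verbatim (`conclC_of_stubs`, lead c2).

Card `Cruxes/OSLegsAtWeakCouplingC/Ideas/axis-cross-analyticity-e1-locality.md`; refs OsterwalderSchrader1975,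
GlimmJaffe1987 §6.1/§19, JaffeWitten2000 §4/§6.
-/

set_option autoImplicit false

noncomputable section

open scoped SchwartzMap ComplexConjugate BigOperators
open MeasureTheory Filter Topology
open Literature.MathematicalPhysics.QuantumFieldTheory Literature.MathematicalPhysics.QuantumLattice
open Literature.MathematicalPhysics.AQFT Literature.Probability.LatticeModels
open Summit.QuantumFields.YangMills.Theses.LangevinControlUV (OSLegsAtWeakCouplingC)
open Summit.QuantumFields.YangMills.Cruxes.OSLegsFromFemtoAndGap.DlrCollarTransfer
open Summit.QuantumFields.YangMills.Theorems.OSLegsFromFemtoAndGap (isHermitian_of_isReflectionPositive)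
open Summit.QuantumFields.YangMills.Theorems.HypercubicLimit.Negative (onlySpecies extendByZero)
open Summit.QuantumFields.YangMills.Theorems (PlanarToEuclidean_proof)

namespace Summit.QuantumFields.YangMills.Cruxes.OSLegsAtWeakCouplingC.Sketch

section Composition

variable {G : Type} [Group G] [TopologicalSpace G] [IsTopologicalGroup G] [CompactSpace G]
  [MeasurableSpace G] [BorelSpace G]

/-- **Rotation half of E1 from signed permutations and det-1 planar isometries** (Givens generation of `SO(4)`,
`PlanarToEuclidean_proof`, which consumes planar invariance at determinant one only). -/
theorem isEuclideanInvariant_of_planarRot (S₁ : SchwingerFamily (EuclideanSpace ℝ (Fin 4)))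
    (htrans : ∀ (n : ℕ) (t : (EuclideanSpace ℝ (Fin 4))) (F : 𝓢((Fin n → (EuclideanSpace ℝ (Fin 4))), ℂ)), IsOffDiagonal F → S₁ n (translateMulti t F) = S₁ n F)
    (hsigned : ∀ R : (EuclideanSpace ℝ (Fin 4)) ≃ₗᵢ[ℝ] (EuclideanSpace ℝ (Fin 4)), IsSignedPerm R → Invariant S₁ R)
    (hplanar : ∀ R : (EuclideanSpace ℝ (Fin 4)) ≃ₗᵢ[ℝ] (EuclideanSpace ℝ (Fin 4)), LinearMap.det (R.toLinearEquiv : (EuclideanSpace ℝ (Fin 4)) →ₗ[ℝ] (EuclideanSpace ℝ (Fin 4))) = 1 → IsPlanar01 R →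
      Invariant S₁ R) :
    S₁.toLabelled.IsEuclideanInvariant := by
  refine ⟨fun n _ t F hF => htrans n t F hF, fun n k R hR F hF => ?_⟩
  exact PlanarToEuclidean_proof Unit S₁.toLabelled (fun n k R _ hR F hF => hsigned R hR n F hF)
    (fun R hdet h2 h3 n k F hF => hplanar R hdet ⟨h2, h3⟩ n F hF) n k R hR F hF

/-- **The line composed with the weaker germ import**: `stub_fcp6`, `stub_rope`, `stub_hypercubic`, `stub_locality`
and germ invariance under det-1 planar isometries — assumed only for soft-bundle limits that are already `RPPos`,
density-bounded and signed-permutation invariant, and with H2 in hand — give `ConclC` for every compact simple `G`,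
every `r`, every continuous unit map carrying H1, H2, H3 (the landed `conclC_of_stubs` with the germ step moved after
the rope, the density bound and the hypercubic symmetries). -/
theorem conclC_of_stubs_germRot (hfcp : Statement.stub_fcp6) (hrope : Statement.stub_rope)
    (hhyp : Statement.stub_hypercubic)
    (hgerm : ∀ (G : Type) [Group G] [TopologicalSpace G] [IsTopologicalGroup G] [CompactSpace G]
      [MeasurableSpace G] [BorelSpace G], IsCompactSimpleLieGroup G →
      ∀ (r : LatticeRep G) (a : ℝ → ℝ) (sch : SpeciesScheme (YMSpecies G)) (S₁ : SchwingerFamily (EuclideanSpace ℝ (Fin 4)))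
        (Tq : (n : ℕ) → (Fin n → Fin 4 × Fin 4) → (𝓢((Fin n → (EuclideanSpace ℝ (Fin 4))), ℂ) →L[ℂ] ℂ)) (K : ℝ) (b₀ : ℝ) (g : ℝ → ℕ → ℕ),
        Continuous a → TwoPoint G r a → Skewness G r a → GapInUnits G r a → SoftBundle G r a sch S₁ Tq K b₀ g →
        RPPos S₁ → OffDiagDensity S₁ → (∀ R : (EuclideanSpace ℝ (Fin 4)) ≃ₗᵢ[ℝ] (EuclideanSpace ℝ (Fin 4)), IsSignedPerm R → Invariant S₁ R) →
          ∃ r₀ : ℝ, 0 < r₀ ∧ ∀ R : (EuclideanSpace ℝ (Fin 4)) ≃ₗᵢ[ℝ] (EuclideanSpace ℝ (Fin 4)), LinearMap.det (R.toLinearEquiv : (EuclideanSpace ℝ (Fin 4)) →ₗ[ℝ] (EuclideanSpace ℝ (Fin 4))) = 1 →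
            IsPlanar01 R → GermInvariant S₁ R r₀)
    (hloc : Statement.stub_locality)
    (hG : IsCompactSimpleLieGroup G) (r : LatticeRep G) (a : ℝ → ℝ) (ha : Continuous a)
    (h1 : TwoPoint G r a) (h2 : Skewness G r a) (h3 : GapInUnits G r a) : ConclC G r a := by
  -- positivity and the limit of the unit map, from H1
  obtain ⟨-, -, -, -, -, -, -, hapos, ha0, -, -⟩ := id h1
  -- hypothesis side: pin, femto package, collar, lower bounds
  have hpin : TwoPointPinned G r a := stubPin_of_continuous G hG r a ha h1 h3
  obtain ⟨hFBL6, hFC2, hFC3⟩ := hfcp G hG r a hpin h2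
  have hMB6 : MomentBounds6 G r a := stub_collar6 G r a hFBL6
  have hLB : LowerBounds G r a := stub_lower G r a hapos ha0 (fbl_of_fbl6 r a hFBL6) hFC2 hFC3
  -- the rope's demands, then the soft bundle meeting them
  obtain ⟨b₀, g, Δ, hΔ, hRD⟩ := hrope G r a hapos ha0 h3
  obtain ⟨sch, S₁, Tq, K, hB⟩ := stub_growth G r a hapos ha0 hMB6 hLB h3 b₀ g
  obtain ⟨hRP, hDec⟩ := hRD sch S₁ Tq K hB
  have hsigned : ∀ R : (EuclideanSpace ℝ (Fin 4)) ≃ₗᵢ[ℝ] (EuclideanSpace ℝ (Fin 4)), IsSignedPerm R → Invariant S₁ R :=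
    fun R hR n F hF => hhyp G r a sch S₁ Tq K b₀ g hB n R hR F hF
  have hdens : OffDiagDensity S₁ := stub_density G r a sch S₁ Tq K b₀ g hMB6 hB
  -- the (weaker) germ import, fed with everything the line has proved about `S₁`
  obtain ⟨r₀, hr₀, hgermR⟩ := hgerm G hG r a sch S₁ Tq K b₀ g ha h1 h2 h3 hB hRP hdens hsigned
  -- unpack the bundle
  obtain ⟨⟨hunits, -, -, hβ, hN, hLG, hE3, htrans, h0, h1', -, -, hYM, hnt, hng, ⟨Δ', hΔ', hlat⟩, -⟩, -⟩ := hB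
  -- continuum side
  obtain ⟨hCS, hgapOf⟩ := stub_gap S₁ h0 htrans hRP
  have hE4 : S₁.toLabelled.HasClusterProperty :=
    stub_cluster S₁ Δ hΔ h0 h1' htrans (fun n R hR F hF => hsigned R hR n F hF) hCS hDec
  have hplanar : ∀ R : (EuclideanSpace ℝ (Fin 4)) ≃ₗᵢ[ℝ] (EuclideanSpace ℝ (Fin 4)), LinearMap.det (R.toLinearEquiv : (EuclideanSpace ℝ (Fin 4)) →ₗ[ℝ] (EuclideanSpace ℝ (Fin 4))) = 1 → IsPlanar01 R →
      Invariant S₁ R := fun R hdet hR =>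
    hloc S₁ h0 htrans hE3 hLG hRP hsigned hdens R hR r₀ hr₀ (hgermR R hdet hR)
  have hE1 : S₁.toLabelled.IsEuclideanInvariant := isEuclideanInvariant_of_planarRot S₁ htrans hsigned hplanar
  have hE2 : S₁.toLabelled.IsReflectionPositive := isReflectionPositive_of_rpPos hRP
  have hherm : S₁.toLabelled.IsHermitian := isHermitian_of_isReflectionPositive S₁ hN hE2
  have hOS : OSAxiomsSchwinger S₁.toLabelled :=
    { normalized := hN, hermitian := hherm, invariant := hE1, reflectionPositive := hE2, symmetric := hE3,
      cluster := hE4, linearGrowth := hLG }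
  have hgap : S₁.toLabelled.HasMassGap Δ := hgapOf Δ hΔ hDec
  -- one field extended by zero to all species
  have hnt' : ∃ (F₁ G₁ : 𝓢((Fin 1 → (EuclideanSpace ℝ (Fin 4))), ℂ)) (H₁ : 𝓢((Fin (1 + 1) → (EuclideanSpace ℝ (Fin 4))), ℂ)),
      IsTimeOrdered F₁ ∧ IsTimeOrdered G₁ ∧ IsAppendTensorOf H₁ (osAdjoint F₁) G₁ ∧
        S₁ (1 + 1) H₁ ≠ S₁ 1 (osAdjoint F₁) * S₁ 1 G₁ := by
    simpa using hnt
  have hng' : ∃ (f g h : 𝓢((EuclideanSpace ℝ (Fin 4)), ℂ)) (Ffgh : 𝓢((Fin 3 → (EuclideanSpace ℝ (Fin 4))), ℂ)) (Fgh Ffh Ffg : 𝓢((Fin 2 → (EuclideanSpace ℝ (Fin 4))), ℂ))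
      (Ff Fg Fh : 𝓢((Fin 1 → (EuclideanSpace ℝ (Fin 4))), ℂ)),
      IsTensorOf Ffgh ![f, g, h] ∧ IsOffDiagonal Ffgh ∧ IsTensorOf Fgh ![g, h] ∧
      IsTensorOf Ffh ![f, h] ∧ IsTensorOf Ffg ![f, g] ∧ IsTensorOf Ff ![f] ∧ IsTensorOf Fg ![g] ∧
      IsTensorOf Fh ![h] ∧
        S₁ 3 Ffgh - S₁ 1 Ff * S₁ 2 Fgh - S₁ 1 Fg * S₁ 2 Ffh - S₁ 1 Fh * S₁ 2 Ffg +
          2 * (S₁ 1 Ff * S₁ 1 Fg * S₁ 1 Fh) ≠ 0 := by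
    simpa using hng
  obtain ⟨T, hYM', hntT, hngT⟩ := exists_osData_of_oneField r sch S₁ hOS hYM hnt' hng'
  exact ⟨onlySpecies sch r.curvature, T, hunits, hβ, hYM', hntT, hngT, Δ', hΔ', hlat⟩

end Composition

/-- **The crux from `stub_fcp6` and the WEAKER germ import** (conditional result): `OSLegsAtWeakCouplingC` BY NAME
from the frozen-boundary femto package and germ invariance under det-1 isometries of the `(x₀,x₁)`-plane, the latter
assumed only for soft-bundle limits that are reflection positive on positive-time tuples, density-bounded off the
diagonal and signed-permutation invariant (all proved by the line), with H1–H3 and continuity in hand; `stub_rope`,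
`stub_hypercubic`, `stub_locality` are discharged by the landed theorems. -/
theorem osLegsAtWeakCouplingC_of_fcp6_germRot (hfcp : Statement.stub_fcp6)
    (hgerm : ∀ (G : Type) [Group G] [TopologicalSpace G] [IsTopologicalGroup G] [CompactSpace G]
      [MeasurableSpace G] [BorelSpace G], IsCompactSimpleLieGroup G →
      ∀ (r : LatticeRep G) (a : ℝ → ℝ) (sch : SpeciesScheme (YMSpecies G)) (S₁ : SchwingerFamily (EuclideanSpace ℝ (Fin 4)))
        (Tq : (n : ℕ) → (Fin n → Fin 4 × Fin 4) → (𝓢((Fin n → (EuclideanSpace ℝ (Fin 4))), ℂ) →L[ℂ] ℂ)) (K : ℝ) (b₀ : ℝ) (g : ℝ → ℕ → ℕ),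
        Continuous a → TwoPoint G r a → Skewness G r a → GapInUnits G r a → SoftBundle G r a sch S₁ Tq K b₀ g →
        RPPos S₁ → OffDiagDensity S₁ → (∀ R : (EuclideanSpace ℝ (Fin 4)) ≃ₗᵢ[ℝ] (EuclideanSpace ℝ (Fin 4)), IsSignedPerm R → Invariant S₁ R) →
          ∃ r₀ : ℝ, 0 < r₀ ∧ ∀ R : (EuclideanSpace ℝ (Fin 4)) ≃ₗᵢ[ℝ] (EuclideanSpace ℝ (Fin 4)), LinearMap.det (R.toLinearEquiv : (EuclideanSpace ℝ (Fin 4)) →ₗ[ℝ] (EuclideanSpace ℝ (Fin 4))) = 1 →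
            IsPlanar01 R → GermInvariant S₁ R r₀) :
    OSLegsAtWeakCouplingC := by
  rw [cruxC_iff]
  intro G _ _ _ _ hG
  letI : MeasurableSpace G := borel G
  haveI : BorelSpace G := ⟨rfl⟩
  intro r a ha h1 h2 h3
  exact conclC_of_stubs_germRot hfcp stub_rope stub_hypercubic hgerm stub_locality hG r a ha h1 h2 h3

/-- The weaker germ import follows from the registered one (`Statement.stub_germ`): drop the extra hypotheses and
the determinant condition. -/
theorem germRot_of_stub_germ (hgerm : Statement.stub_germ) :
    ∀ (G : Type) [Group G] [TopologicalSpace G] [IsTopologicalGroup G] [CompactSpace G]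
      [MeasurableSpace G] [BorelSpace G], IsCompactSimpleLieGroup G →
      ∀ (r : LatticeRep G) (a : ℝ → ℝ) (sch : SpeciesScheme (YMSpecies G)) (S₁ : SchwingerFamily (EuclideanSpace ℝ (Fin 4)))
        (Tq : (n : ℕ) → (Fin n → Fin 4 × Fin 4) → (𝓢((Fin n → (EuclideanSpace ℝ (Fin 4))), ℂ) →L[ℂ] ℂ)) (K : ℝ) (b₀ : ℝ) (g : ℝ → ℕ → ℕ),
        Continuous a → TwoPoint G r a → Skewness G r a → GapInUnits G r a → SoftBundle G r a sch S₁ Tq K b₀ g →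
        RPPos S₁ → OffDiagDensity S₁ → (∀ R : (EuclideanSpace ℝ (Fin 4)) ≃ₗᵢ[ℝ] (EuclideanSpace ℝ (Fin 4)), IsSignedPerm R → Invariant S₁ R) →
          ∃ r₀ : ℝ, 0 < r₀ ∧ ∀ R : (EuclideanSpace ℝ (Fin 4)) ≃ₗᵢ[ℝ] (EuclideanSpace ℝ (Fin 4)), LinearMap.det (R.toLinearEquiv : (EuclideanSpace ℝ (Fin 4)) →ₗ[ℝ] (EuclideanSpace ℝ (Fin 4))) = 1 →
            IsPlanar01 R → GermInvariant S₁ R r₀ := by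
  intro G _ _ _ _ _ _ hG r a sch S₁ Tq K b₀ g ha h1 _ h3 hB _ _ _
  obtain ⟨r₀, hr₀, h⟩ := hgerm G hG r a sch S₁ Tq K b₀ g ha h1 h3 hB
  exact ⟨r₀, hr₀, fun R _ hR => h R hR⟩

end Summit.QuantumFields.YangMills.Cruxes.OSLegsAtWeakCouplingC.Sketch

end
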